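import Literature.MathematicalPhysics.QuantumFieldTheory.Balaban1983to89.TraceWordsSeparateOrbitsUnitary
import Literature.LinearAlgebra.Matrix.FormUnitarySimultaneousSimilarity
import HarnessLib

/-!
# Word traces separate simultaneous-conjugation orbits in the compact symplectic groups `Sp(n) = U(2n) ∩ Sp(2n, ℂ)`
# (and in every form-preserving compact group `G_J = {g ∈ U(N) : gᵀ J g = J}`, `J` unitary, `Jᵀ = ±J`) — module XXI's
# hypothesis `TraceWordsSeparateOrbits` for the SYMPLECTIC gauge groups, hence `(3a) ⟺ (W-corr)` for `Sp(n)` lattice gauge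
# theories with no density hypothesis ([Levy2004] Abstract p.2, Prop. 3.4, §7)

statement-level skeleton of published theorems with citation tags; proofs where landed; nothing here is a claim about
the Yang–Mills mass gap

Companion of `TraceWordsSeparateOrbitsUnitary` (`U(N)`, `SU(N)`) and `TraceWordsSeparateOrbitsOrthogonal` (`O(N)`,
`SO(2m+1)`), whose HONEST SCOPE left «symplectic groups are not treated».  Module XXI (`InfiniteVolumeSufficientXXI`)
reduces Lévy's density theorem on `ℤ^d` and the equivalence `(3a) ⟺ (W-corr)` (unique infinite-volume limit of the torus
states ⟺ convergence of all finite Wilson-loop correlations) to the orbit-separation schema `TraceWordsSeparateOrbits ρ`.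

THE PRINT.  [Levy2004] = T. Lévy, *Wilson loops in the light of spin networks*, J. Geom. Phys. 52 (2004), arXiv
math-ph/0306059 (held `paper:arxiv-math-ph_0306059`).  Abstract (p.2): «If G is any finite product of orthogonal, unitary
and symplectic matrix groups, then Wilson loops generate a dense subalgebra of continuous observables on the configuration
space of lattice gauge theory with structure group G. If G is orthogonal, unitary or symplectic, then Wilson loops
associated to the natural representation of G are enough.»  §3 p.5: «By the symplectic group Sp(n) we mean the subgroup
U(2n) ∩ Sp_{2n}ℂ of GL_{2n}ℂ» (footnote: `Sp_{2n}ℂ` preserves «the skew-symmetric form whose matrix in the canonical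
basis is (0 I; −I 0)»); Prop. 3.4 p.5: «If g and g′ are two points of G^r such that for all word w in r letters and their
inverses, the elements w(g) and w(g′) of G are conjugate, then g and g′ belong to the same diagonal conjugacy class.»;
§7 pp.10–11 proves the orthogonal and symplectic cases from the first fundamental theorem (Thm 7.1, [FH]).

WHAT IS PROVED HERE (kernel-checked):
* §1 `formUnitaryGroup J ≤ U(n)` — the form-preserving compact group `G_J = {g ∈ U(n) : gᵀ J g = J}` for ANY matrix `J`
  (a closed subgroup; `CompactSpace`, Borel instances), its standard representation `formUnitaryRep J` (the inclusion
  into `M_n(ℂ)`, continuous and faithful).  For `J = Matrix.J l ℂ` the membership condition is Mathlib's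
  `Matrix.symplecticGroup` one (`mem_formUnitaryGroup_J_iff`, `SymplecticGroup.mem_iff'`), so `G_J = U(2n) ∩ Sp(2n, ℂ)`
  is Lévy's `Sp(n)`; the same membership condition is used by the tree's `Federbush1986.UN.formSubgroup` and
  `LogChartBilinearForm.compactSymplecticLogChart` (other carriers, not imported here).
* §2 **`traceWordsSeparateOrbits_formUnitaryGroup`** — for `J ∈ U(N)` with `Jᵀ = J` or `Jᵀ = −J`: equal real/imaginary
  parts of the traces of all words in `V_i^{±1}` and in `W_i^{±1}` (`V, W : ι → G_J`) force `W = Q V Q⁻¹` for ONE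
  `Q ∈ G_J`.  Proof (DEVIATION from Lévy's FFT route, as in the companion files): the word traces are the character of the
  free group through `ρ ∘ FreeGroup.lift`, so the tree's `exists_unitary_conj_of_trace_freeGroup_lift_eq` (Specht /
  Wedderburn) gives a conjugator in `U(N)`, and the `J`-twisted Horn–Johnson 2.5.21
  (`Literature.LinearAlgebra.Matrix.exists_formUnitary_conj_of_unitary_conj`) replaces it by one in `G_J`.
* §3 the STANDARD compact symplectic group: `sympJ n` = Mathlib's `Matrix.J (Fin n) ℂ = (0 −I; I 0)` (= minus Lévy's
  `(0 I; −I 0)`, same group) re-indexed along `Fin n ⊕ Fin n ≃ Fin (n+n)` (unitary, `sympJᵀ = −sympJ`, `sympJ² = −1`);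
  `symplecticRep n` = the natural representation of `Sp(n) := formUnitaryGroup (sympJ n)` on `ℂ^{2n}`
  (`mem_formUnitaryGroup_sympJ_iff`: = `U(2n) ∩ Matrix.symplecticGroup`); **`traceWordsSeparateOrbits_symplecticGroup n`**.
* §4 HEADLINES by module XXI PART C, by name: `traceWordsDense_symplecticGroup`, `spansGaugeInvariantCylinders_…`
  (Lévy's density on `ℤ^d` for the natural representation of `Sp(n)` — the Abstract's second sentence, symplectic case)
  and `hasUniqueInfiniteVolumeLimit_iff_hasWilsonLoopCorrelationLimits_symplecticGroup (n) (β)`: for `Sp(n)` lattice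
  gauge theory in any dimension at any real `β`, `(3a) ⟺ (W-corr)` with NO hypothesis left; the same three for every
  `G_J` with `J` unitary, `Jᵀ = ±J` (`…_formUnitaryGroup`).

HONEST SCOPE.  Nothing about the torus states themselves is proved; `(3a)` and `(W-corr)` are both unproved properties;
NOT summit progress.  Only ONE representation (the natural one) is used, which is what Lévy's Abstract asserts suffices for
`Sp(n)`; his Thm 3.1 (all representations, products of groups) is not formalised.  `SO(2m)` stays uncovered (its natural
representation does NOT separate orbits: `not_traceWordsSeparateOrbits_so2Rep` in module XXI for `m = 1`).
Cell context: lit-balaban (HOME `run/shared/lean/pub/lit-balaban/`), unit p24 gen 19, free-target protocol G.5-34(d);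
cross-cell record pub-balaban `ir/SUFFICIENT.md` §25 (e); no SKELETON row.
-/

namespace Literature.MathematicalPhysics.QuantumFieldTheory.Balaban1983to89.TraceWordsSeparateOrbitsSymplectic

open Literature.MathematicalPhysics.QuantumLattice
open Balaban1983to89.Missing (TraceWordsSeparateOrbits TraceWordsDense SpansGaugeInvariantCylinders
  HasWilsonLoopCorrelationLimits)
open TraceWordsSeparateOrbitsUnitary (wordVal_eq_freeGroup_lift)
open scoped Matrix ComplexConjugate

noncomputable section

/-! ## §1 The form-preserving compact groups `G_J = {g ∈ U(n) : gᵀ J g = J}` and their standard representation -/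

section FormUnitaryGroup

variable {n : Type*} [Fintype n] [DecidableEq n]

/-- **The form-preserving compact group `G_J = {g ∈ U(n) : gᵀ J g = J}`** as a subgroup of the unitary group (any `J`):
for `J = 1` the real orthogonal group `O(n) = U(n) ∩ O(n, ℂ)`, for `J = ±(0 I; −I 0)` the compact symplectic group
«Sp(n) … the subgroup U(2n) ∩ Sp_{2n}ℂ of GL_{2n}ℂ» ([Levy2004] §3 p.5; `mem_formUnitaryGroup_J_iff`).
[cite: Levy2004, §3 p.5] -/
def formUnitaryGroup (J : Matrix n n ℂ) : Subgroup (Matrix.unitaryGroup n ℂ) where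
  carrier := {g | (g : Matrix n n ℂ)ᵀ * J * (g : Matrix n n ℂ) = J}
  mul_mem' := by
    intro g h hg hh
    change ((g * h : Matrix.unitaryGroup n ℂ) : Matrix n n ℂ)ᵀ * J * ((g * h : Matrix.unitaryGroup n ℂ) : Matrix n n ℂ) = J
    change (g : Matrix n n ℂ)ᵀ * J * (g : Matrix n n ℂ) = J at hg
    change (h : Matrix n n ℂ)ᵀ * J * (h : Matrix n n ℂ) = J at hh
    rw [Submonoid.coe_mul, Matrix.transpose_mul]
    calc (h : Matrix n n ℂ)ᵀ * (g : Matrix n n ℂ)ᵀ * J * ((g : Matrix n n ℂ) * (h : Matrix n n ℂ))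
        = (h : Matrix n n ℂ)ᵀ * ((g : Matrix n n ℂ)ᵀ * J * (g : Matrix n n ℂ)) * (h : Matrix n n ℂ) := by
          simp only [Matrix.mul_assoc]
      _ = J := by rw [hg, hh]
  one_mem' := by
    change ((1 : Matrix.unitaryGroup n ℂ) : Matrix n n ℂ)ᵀ * J * ((1 : Matrix.unitaryGroup n ℂ) : Matrix n n ℂ) = J
    rw [Submonoid.coe_one, Matrix.transpose_one, Matrix.one_mul, Matrix.mul_one]
  inv_mem' := by
    intro g hg
    change (g : Matrix n n ℂ)ᵀ * J * (g : Matrix n n ℂ) = J at hg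
    change (star (g : Matrix n n ℂ))ᵀ * J * star (g : Matrix n n ℂ) = J
    have h1 : (g : Matrix n n ℂ) * star (g : Matrix n n ℂ) = 1 := Matrix.mem_unitaryGroup_iff.mp g.2
    have h2 : (star (g : Matrix n n ℂ))ᵀ * (g : Matrix n n ℂ)ᵀ = 1 := by
      rw [← Matrix.transpose_mul, h1, Matrix.transpose_one]
    calc (star (g : Matrix n n ℂ))ᵀ * J * star (g : Matrix n n ℂ)
        = (star (g : Matrix n n ℂ))ᵀ * ((g : Matrix n n ℂ)ᵀ * J * (g : Matrix n n ℂ)) * star (g : Matrix n n ℂ) := by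
          rw [hg]
      _ = ((star (g : Matrix n n ℂ))ᵀ * (g : Matrix n n ℂ)ᵀ) * J * ((g : Matrix n n ℂ) * star (g : Matrix n n ℂ)) := by
          simp only [Matrix.mul_assoc]
      _ = J := by rw [h1, h2, Matrix.one_mul, Matrix.mul_one]

variable {J : Matrix n n ℂ}

/-- Membership in `G_J`: `gᵀ J g = J`. [cite: Levy2004, §3 p.5] -/
theorem mem_formUnitaryGroup_iff {g : Matrix.unitaryGroup n ℂ} :
    g ∈ formUnitaryGroup J ↔ (g : Matrix n n ℂ)ᵀ * J * (g : Matrix n n ℂ) = J := Iff.rfl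

/-- **For Mathlib's `J = (0 −I; I 0)` on `l ⊕ l`, `G_J = U ∩ Sp`:** a unitary `g` lies in `formUnitaryGroup (Matrix.J l ℂ)`
iff `g ∈ Matrix.symplecticGroup l ℂ` (Mathlib's `SymplecticGroup.mem_iff'`: `Aᵀ J A = J`) — Lévy's «U(2n) ∩ Sp_{2n}ℂ»
(his `(0 I; −I 0)` is `−J`, which defines the same group). [cite: Levy2004, §3 p.5] -/
theorem mem_formUnitaryGroup_J_iff {l : Type*} [Fintype l] [DecidableEq l] {g : Matrix.unitaryGroup (l ⊕ l) ℂ} :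
    g ∈ formUnitaryGroup (Matrix.J l ℂ) ↔ (g : Matrix (l ⊕ l) (l ⊕ l) ℂ) ∈ Matrix.symplecticGroup l ℂ := by
  rw [mem_formUnitaryGroup_iff, SymplecticGroup.mem_iff']

variable (J)

/-- The STANDARD (natural) representation of `G_J` on `ℂⁿ`: the inclusion `G_J ⊂ U(n) ⊂ M_n(ℂ)` ([Levy2004] §5 p.7: «G acts
by left multiplication on V = ℂⁿ and this is called the natural representation»). [cite: Levy2004, §5 p.7] -/
def formUnitaryRep : formUnitaryGroup J →* Matrix n n ℂ :=
  (unitaryFundamentalRep n ℂ).comp (formUnitaryGroup J).subtype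

/-- `formUnitaryRep J g = g` as a matrix. [cite: Levy2004, §5 p.7] -/
@[simp] theorem formUnitaryRep_apply (g : formUnitaryGroup J) :
    formUnitaryRep J g = ((g : Matrix.unitaryGroup n ℂ) : Matrix n n ℂ) := rfl

/-- The natural representation of `G_J` is continuous. [cite: Levy2004, §5 p.7] -/
theorem continuous_formUnitaryRep : Continuous (formUnitaryRep J) :=
  (continuous_unitaryFundamentalRep n ℂ).comp continuous_subtype_val

/-- The natural representation of `G_J` is faithful. [cite: Levy2004, §5 p.7] -/
theorem formUnitaryRep_injective : Function.Injective (formUnitaryRep J) :=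
  (unitaryFundamentalRep_injective n ℂ).comp Subtype.val_injective

/-- `G_J` is closed in `U(n)`. [folklore] -/
private theorem isClosed_formUnitaryGroup : IsClosed (formUnitaryGroup J : Set (Matrix.unitaryGroup n ℂ)) := by
  have hcont : Continuous fun g : Matrix.unitaryGroup n ℂ => (g : Matrix n n ℂ)ᵀ * J * (g : Matrix n n ℂ) :=
    (continuous_subtype_val.matrix_transpose.matrix_mul continuous_const).matrix_mul continuous_subtype_val
  exact isClosed_eq hcont continuous_const

/-- `G_J` is compact (a closed subgroup of the compact group `U(n)`). [folklore] -/
instance instCompactSpace : CompactSpace (formUnitaryGroup J) :=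
  isCompact_iff_compactSpace.mp (isClosed_formUnitaryGroup J).isCompact

/-- Borel σ-algebra on `G_J`. [folklore] -/
instance instMeasurableSpace : MeasurableSpace (formUnitaryGroup J) := borel _

/-- `G_J` is a Borel space (by definition of its σ-algebra). [folklore] -/
instance instBorelSpace : BorelSpace (formUnitaryGroup J) := ⟨rfl⟩

/-- `G_J` is second countable (a subspace of `M_n(ℂ)`). [folklore] -/
private theorem formUnitaryGroup_secondCountable : SecondCountableTopology (formUnitaryGroup J) :=
  haveI : SecondCountableTopology (Matrix n n ℂ) := inferInstanceAs (SecondCountableTopology (n → n → ℂ))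
  haveI : SecondCountableTopology (Matrix.unitaryGroup n ℂ) :=
    Topology.IsEmbedding.subtypeVal.secondCountableTopology
  Topology.IsEmbedding.subtypeVal.secondCountableTopology

end FormUnitaryGroup

/-! ## §2 Orbit separation in `G_J` for `J` unitary with `Jᵀ = ±J` -/

section Orbits

variable {N : ℕ}

/-- Equal `Re`/`Im` parts of the word traces ⟹ equal complex traces of `ρ(w(V))`, `ρ(w(W))` for every element of the free
group (module XX's `wordVal` is `FreeGroup.lift`, `wordVal_eq_freeGroup_lift`). [folklore] -/
private theorem trace_lift_eq_of_tracePart_eq {G : Type*} [Group G] (ρ : G →* Matrix (Fin N) (Fin N) ℂ)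
    {ι : Type*} (V W : ι → G)
    (h : ∀ (w : List (ι × Bool)) (b : Bool), tracePart ρ b (wordVal w V) = tracePart ρ b (wordVal w W))
    (w : FreeGroup ι) : (ρ (FreeGroup.lift V w)).trace = (ρ (FreeGroup.lift W w)).trace := by
  classical
  rw [← FreeGroup.mk_toWord (x := w), ← wordVal_eq_freeGroup_lift, ← wordVal_eq_freeGroup_lift]
  exact Complex.ext (h _ true) (h _ false)

/-- **WORD TRACES SEPARATE THE SIMULTANEOUS-CONJUGATION ORBITS OF `G_J^ι`** for every unitary `J ∈ M_N(ℂ)` with `Jᵀ = J`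
or `Jᵀ = −J` — module XXI's schema `TraceWordsSeparateOrbits (formUnitaryRep J)`: if `Re/Im tr w(V) = Re/Im tr w(W)` for
all words `w` in `i^{±1}` (`V, W : ι → G_J`), then `W i = Q V i Q⁻¹` for one `Q ∈ G_J`.  (For `Jᵀ = −J`: Lévy's Prop. 3.4
for `Sp(n)` in the natural representation, the Abstract's «Wilson loops associated to the natural representation of G are
enough»; proof here by Specht/Wedderburn + the `J`-twisted Horn–Johnson 2.5.21 instead of the FFT.)
[cite: Levy2004, Prop 3.4 p.5] -/
theorem traceWordsSeparateOrbits_formUnitaryGroup (J : Matrix (Fin N) (Fin N) ℂ)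
    (hJ : J ∈ Matrix.unitaryGroup (Fin N) ℂ) (hJT : Jᵀ = J ∨ Jᵀ = -J) :
    TraceWordsSeparateOrbits (formUnitaryRep J) := by
  intro ι _ V W h
  have hρ : ∀ g : formUnitaryGroup J, (formUnitaryRep J g)ᴴ = formUnitaryRep J g⁻¹ := fun g => by
    rw [formUnitaryRep_apply, formUnitaryRep_apply, ← Matrix.star_eq_conjTranspose]
    rfl
  obtain ⟨u, hu, hc⟩ := Literature.LinearAlgebra.Matrix.exists_unitary_conj_of_trace_freeGroup_lift_eq
    (formUnitaryRep J) hρ V W (trace_lift_eq_of_tracePart_eq _ V W h)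
  simp only [formUnitaryRep_apply] at hc
  obtain ⟨Q, hQ, hQJ, hQc⟩ := Literature.LinearAlgebra.Matrix.exists_formUnitary_conj_of_unitary_conj J hJ hJT
    (fun i => ((V i : Matrix.unitaryGroup (Fin N) ℂ) : Matrix (Fin N) (Fin N) ℂ))
    (fun i => ((W i : Matrix.unitaryGroup (Fin N) ℂ) : Matrix (Fin N) (Fin N) ℂ))
    (fun i => (V i : Matrix.unitaryGroup (Fin N) ℂ).2) (fun i => (V i).2)
    (fun i => (W i : Matrix.unitaryGroup (Fin N) ℂ).2) (fun i => (W i).2) u hu hc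
  refine ⟨⟨⟨Q, hQ⟩, hQJ⟩, fun i => Subtype.ext (Subtype.ext ?_)⟩
  change ((W i : Matrix.unitaryGroup (Fin N) ℂ) : Matrix (Fin N) (Fin N) ℂ) =
    Q * ((V i : Matrix.unitaryGroup (Fin N) ℂ) : Matrix (Fin N) (Fin N) ℂ) * star Q
  rw [hQc i, Matrix.star_eq_conjTranspose]

end Orbits

/-! ## §3 The standard compact symplectic group `Sp(n) = U(2n) ∩ Sp(2n, ℂ)` on `ℂ^{2n} = ℂ^{Fin (n+n)}` -/

section Symplectic

/-- **The standard skew form on `ℂ^{2n}`**: Mathlib's `Matrix.J (Fin n) ℂ = (0 −I; I 0)` (block matrix on `Fin n ⊕ Fin n`)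
re-indexed along `finSumFinEquiv : Fin n ⊕ Fin n ≃ Fin (n + n)` (module XXI's schema wants `Fin`-indexed matrices).  This is
the NEGATIVE (= transpose = inverse) of Lévy's printed matrix «(0 I; −I 0)» (p.5 footnote); both define the same group,
since `gᵀ(−J)g = −J ⟺ gᵀJg = J`. [cite: Levy2004, §3 p.5] -/
def sympJ (n : ℕ) : Matrix (Fin (n + n)) (Fin (n + n)) ℂ :=
  Matrix.reindex finSumFinEquiv finSumFinEquiv (Matrix.J (Fin n) ℂ)

/-- `sympJ` is skew-symmetric (Mathlib `Matrix.J_transpose`). [cite: Levy2004, §3 p.5] -/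
theorem sympJ_transpose (n : ℕ) : (sympJ n)ᵀ = -sympJ n := by
  rw [sympJ, Matrix.transpose_reindex, Matrix.J_transpose]
  ext i j
  simp

/-- `sympJ² = −1` (Mathlib `Matrix.J_squared`). [cite: Levy2004, §3 p.5] -/
theorem sympJ_mul_sympJ (n : ℕ) : sympJ n * sympJ n = -1 := by
  rw [sympJ, Matrix.reindex_apply, Matrix.submatrix_mul_equiv, Matrix.J_squared]
  ext i j
  simp [Matrix.one_apply]

/-- `(0 −I; I 0)ᴴ = −(0 −I; I 0)` (real entries, skew). [folklore] -/
private theorem matrixJ_conjTranspose (n : ℕ) : (Matrix.J (Fin n) ℂ)ᴴ = -Matrix.J (Fin n) ℂ := by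
  rw [Matrix.J, Matrix.fromBlocks_conjTranspose, Matrix.conjTranspose_zero, Matrix.conjTranspose_one,
    Matrix.conjTranspose_neg, Matrix.conjTranspose_one, Matrix.fromBlocks_neg, neg_zero, neg_neg]

/-- `sympJᴴ = −sympJ` (real entries). [cite: Levy2004, §3 p.5] -/
theorem sympJ_conjTranspose (n : ℕ) : (sympJ n)ᴴ = -sympJ n := by
  rw [sympJ, Matrix.conjTranspose_reindex, matrixJ_conjTranspose]
  ext i j
  simp

/-- `sympJ` is unitary: `J Jᴴ = J(−J) = 1`. [cite: Levy2004, §3 p.5] -/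
theorem sympJ_mem_unitaryGroup (n : ℕ) : sympJ n ∈ Matrix.unitaryGroup (Fin (n + n)) ℂ := by
  rw [Matrix.mem_unitaryGroup_iff, Matrix.star_eq_conjTranspose, sympJ_conjTranspose, Matrix.mul_neg, sympJ_mul_sympJ,
    neg_neg]

/-- NON-VACUITY: `sympJ` itself lies in `Sp(n) = formUnitaryGroup (sympJ n)` (`Jᵀ J J = (−J)(−1) = J`). [cite: Levy2004, §3 p.5] -/
theorem sympJ_mem_formUnitaryGroup (n : ℕ) :
    (⟨sympJ n, sympJ_mem_unitaryGroup n⟩ : Matrix.unitaryGroup (Fin (n + n)) ℂ) ∈ formUnitaryGroup (sympJ n) := by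
  rw [mem_formUnitaryGroup_iff]
  change (sympJ n)ᵀ * sympJ n * sympJ n = sympJ n
  rw [sympJ_transpose, Matrix.mul_assoc, sympJ_mul_sympJ, Matrix.mul_neg, Matrix.mul_one, neg_neg]

/-- **`Sp(n) = formUnitaryGroup (sympJ n)` IS `U(2n) ∩ Sp(2n, ℂ)`** with Mathlib's `Matrix.symplecticGroup (Fin n) ℂ` after
re-indexing `Fin (n+n) ≃ Fin n ⊕ Fin n`. [cite: Levy2004, §3 p.5] -/
theorem mem_formUnitaryGroup_sympJ_iff {n : ℕ} {g : Matrix.unitaryGroup (Fin (n + n)) ℂ} :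
    g ∈ formUnitaryGroup (sympJ n) ↔
      Matrix.reindex finSumFinEquiv.symm finSumFinEquiv.symm (g : Matrix (Fin (n + n)) (Fin (n + n)) ℂ) ∈
        Matrix.symplecticGroup (Fin n) ℂ := by
  rw [mem_formUnitaryGroup_iff, SymplecticGroup.mem_iff']
  set e : Fin n ⊕ Fin n ≃ Fin (n + n) := finSumFinEquiv
  let φ := Matrix.reindexAlgEquiv ℂ ℂ e.symm
  have hφ : ∀ M : Matrix (Fin (n + n)) (Fin (n + n)) ℂ, φ M = Matrix.reindex e.symm e.symm M := fun M => rfl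
  have hJ : φ (sympJ n) = Matrix.J (Fin n) ℂ := by
    rw [hφ, sympJ]
    ext i j
    simp [e]
  constructor
  · intro h
    have := congrArg φ h
    rw [map_mul, map_mul, hJ, hφ, hφ, ← Matrix.transpose_reindex] at this
    exact this
  · intro h
    apply φ.injective
    rw [map_mul, map_mul, hJ, hφ, hφ, ← Matrix.transpose_reindex]
    exact h

/-- **The natural representation of `Sp(n)` on `ℂ^{2n}`** («Recall that the elements of Sp(n) are complex matrices of size
2n», [Levy2004] §5 p.7 footnote): `symplecticRep n := formUnitaryRep (sympJ n)`. [cite: Levy2004, §5 p.7] -/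
abbrev symplecticRep (n : ℕ) : formUnitaryGroup (sympJ n) →* Matrix (Fin (n + n)) (Fin (n + n)) ℂ :=
  formUnitaryRep (sympJ n)

/-- **WORD TRACES SEPARATE THE SIMULTANEOUS-CONJUGATION ORBITS OF `Sp(n)^ι`** — module XXI's schema
`TraceWordsSeparateOrbits (symplecticRep n)` for the compact symplectic group `Sp(n) = U(2n) ∩ Sp(2n, ℂ)` in its natural
representation, every `n`. [cite: Levy2004, Prop 3.4 p.5] -/
theorem traceWordsSeparateOrbits_symplecticGroup (n : ℕ) : TraceWordsSeparateOrbits (symplecticRep n) :=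
  traceWordsSeparateOrbits_formUnitaryGroup (sympJ n) (sympJ_mem_unitaryGroup n) (Or.inr (sympJ_transpose n))

end Symplectic

/-! ## §4 HEADLINES: density and `(3a) ⟺ (W-corr)` for `G_J` (`J` unitary, `Jᵀ = ±J`) and for `Sp(n)` -/

section Headlines

variable {d N : ℕ}

/-- **`G_J`, `J` unitary with `Jᵀ = ±J`: the several-variable density schema of module XX holds** — polynomials in the
word traces are uniformly dense in the continuous functions on `G_J^ι` invariant under simultaneous conjugation (orbit
separation + Stone–Weierstrass, module XXI PART C). [cite: Levy2004, Prop 3.4 p.5] -/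
theorem traceWordsDense_formUnitaryGroup (J : Matrix (Fin N) (Fin N) ℂ) (hJ : J ∈ Matrix.unitaryGroup (Fin N) ℂ)
    (hJT : Jᵀ = J ∨ Jᵀ = -J) : TraceWordsDense (formUnitaryRep J) :=
  traceWordsDense_of_traceWordsSeparateOrbits _ (continuous_formUnitaryRep J)
    (traceWordsSeparateOrbits_formUnitaryGroup J hJ hJT)

/-- **`G_J`, `J` unitary with `Jᵀ = ±J`: Lévy's density on `ℤ^d`** — the real span of the finite products of Wilson loops
`Re/Im tr U_ℓ` (natural representation) is sup-norm dense in the gauge-invariant continuous cylinder functions, every `d`.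
[cite: Levy2004, Thm 3.1 p.5] -/
theorem spansGaugeInvariantCylinders_formUnitaryGroup (J : Matrix (Fin N) (Fin N) ℂ)
    (hJ : J ∈ Matrix.unitaryGroup (Fin N) ℂ) (hJT : Jᵀ = J ∨ Jᵀ = -J) :
    SpansGaugeInvariantCylinders d (wilsonLoopProducts (formUnitaryRep J) d) :=
  spansGaugeInvariantCylinders_of_traceWordsDense _ (traceWordsDense_formUnitaryGroup J hJ hJT)

/-- **`G_J`, `J` unitary with `Jᵀ = ±J`: `(3a) ⟺ (W-corr)` UNCONDITIONALLY** — `G_J` lattice gauge theory in dimension `d`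
at real coupling `β` has a unique infinite-volume limit of its torus states iff every finite Wilson-loop correlation
converges as `L → ∞`. [cite: Levy2004, Thm 3.1 p.5] -/
theorem hasUniqueInfiniteVolumeLimit_iff_hasWilsonLoopCorrelationLimits_formUnitaryGroup (J : Matrix (Fin N) (Fin N) ℂ)
    (hJ : J ∈ Matrix.unitaryGroup (Fin N) ℂ) (hJT : Jᵀ = J ∨ Jᵀ = -J) (β : ℝ) :
    HasUniqueInfiniteVolumeLimit (d := d) (formUnitaryRep J) β ↔
      HasWilsonLoopCorrelationLimits (formUnitaryRep J) d β := by
  haveI := formUnitaryGroup_secondCountable J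
  exact hasUniqueInfiniteVolumeLimit_iff_hasWilsonLoopCorrelationLimits_of_traceWordsSeparateOrbits _
    (continuous_formUnitaryRep J) (traceWordsSeparateOrbits_formUnitaryGroup J hJ hJT) β

/-- **`Sp(n)`, every `n`: the several-variable density schema of module XX holds.** [cite: Levy2004, Prop 3.4 p.5] -/
theorem traceWordsDense_symplecticGroup (n : ℕ) : TraceWordsDense (symplecticRep n) :=
  traceWordsDense_formUnitaryGroup (sympJ n) (sympJ_mem_unitaryGroup n) (Or.inr (sympJ_transpose n))

/-- **`Sp(n)`, every `n`: Lévy's density on `ℤ^d` for the NATURAL representation** («If G is orthogonal, unitary or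
symplectic, then Wilson loops associated to the natural representation of G are enough», Abstract p.2 — the symplectic
case, transported to `ℤ^d` by module XX). [cite: Levy2004, Thm 3.1 p.5] -/
theorem spansGaugeInvariantCylinders_symplecticGroup (n : ℕ) :
    SpansGaugeInvariantCylinders d (wilsonLoopProducts (symplecticRep n) d) :=
  spansGaugeInvariantCylinders_formUnitaryGroup (sympJ n) (sympJ_mem_unitaryGroup n) (Or.inr (sympJ_transpose n))

/-- **HEADLINE — `Sp(n)` FOR EVERY `n` (`Sp(1) = SU(2)`, `Sp(2)`, …): `(3a) ⟺ (W-corr)` UNCONDITIONALLY.**  The compact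
symplectic lattice gauge theory in dimension `d` at real coupling `β` has a unique infinite-volume limit of its torus
states (`HasUniqueInfiniteVolumeLimit`) iff every finite Wilson-loop correlation in the natural representation converges as
`L → ∞` (`HasWilsonLoopCorrelationLimits`). [cite: Levy2004, Thm 3.1 p.5] -/
theorem hasUniqueInfiniteVolumeLimit_iff_hasWilsonLoopCorrelationLimits_symplecticGroup (n : ℕ) (β : ℝ) :
    HasUniqueInfiniteVolumeLimit (d := d) (symplecticRep n) β ↔ HasWilsonLoopCorrelationLimits (symplecticRep n) d β :=
  hasUniqueInfiniteVolumeLimit_iff_hasWilsonLoopCorrelationLimits_formUnitaryGroup (sympJ n) (sympJ_mem_unitaryGroup n)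
    (Or.inr (sympJ_transpose n)) β

end Headlines

end

end Literature.MathematicalPhysics.QuantumFieldTheory.Balaban1983to89.TraceWordsSeparateOrbitsSymplectic
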